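import Mathlib
import Literature.Geometry.Symplectic.JHolomorphicMap
import Summits.SmoothPoincare4.SmoothPoincare4.Theorems.SullivanDualTameOrBrodyR4AprioriCalculus
import Summits.SmoothPoincare4.SmoothPoincare4.Theorems.SullivanDualTameOrBrodyR4AprioriEnergy

/-!
# A-priori estimate for `J`-holomorphic maps: part 5, step β

Helper file of the lead (c2) for stub `stub_aprioriOf` of line `Sketch`, crux `TameOrBrodyR4`
(stmt-SmoothPoincare4-7826, route SullivanDual). Step β of the bootstrapping (registered sub-goal `beta`): `∫_{D_{ρ'}} ‖Dⁿg‖⁴ ≤ C (∫_{D_ρ} ‖Dⁿg‖²)(∫_{D_ρ} ‖D^{n+1}g‖² + ∫_{D_ρ} ‖Dⁿg‖²)` from Ladyzhenskaya's inequality (stub `stub_ladyzhenskaya`) applied to the localised words.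
-/

noncomputable section

open scoped ContDiff Topology Nat
open Filter Set Literature.Geometry.Symplectic

-- the registered namespace `Summit.SmoothPoincare4.SmoothPoincare4.…` repeats a component
set_option linter.dupNamespace false

namespace Summit.SmoothPoincare4.SmoothPoincare4.Cruxes.TameOrBrodyR4.Sketch

/-- Local notation for the model space `ℝ⁴ = EuclideanSpace ℝ (Fin 4)`. -/
local notation "E4" => EuclideanSpace ℝ (Fin 4)

namespace Apriori

/-! ### Step β: an `L⁴` bound from `L²` bounds (Ladyzhenskaya) -/

section Beta

open MeasureTheory Metric

/-- **Step β for one word.** For `C^∞` maps `w` with `‖w‖ ≤ y`, `‖∂ᵢw‖ ≤ x` and a cut-off `χ`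
(`|χ| ≤ 1`, `‖dχ‖ ≤ C_χ`, support in the disc of radius `ρ`), Ladyzhenskaya's inequality for
`χ w` gives `∫ ‖χ w‖⁴ ≤ C_L (∫_{D_ρ} y²) (4 ∫_{D_ρ} x² + 4 C_χ² ∫_{D_ρ} y²)`. -/
theorem beta_word {CL : ℝ}
    (hL : ∀ (W : ℂ → E4), ContDiff ℝ ∞ W → HasCompactSupport W →
      (∫ z, ‖W z‖ ^ 4) ≤ CL * ((∫ z, ‖W z‖ ^ 2) *
        ∫ z, (‖fderiv ℝ W z 1‖ ^ 2 + ‖fderiv ℝ W z Complex.I‖ ^ 2)))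
    (hCL : 0 ≤ CL) (w : ℂ → E4) (hw : ContDiff ℝ ∞ w) (χ : ℂ → ℝ) (hχ : ContDiff ℝ ∞ χ)
    (hχc : HasCompactSupport χ) {ρ Cχ : ℝ} (hsupp : ∀ z ∈ tsupport χ, ‖z‖ ≤ ρ)
    (hχ1 : ∀ z, |χ z| ≤ 1) (hCχ : ∀ z v, ‖fderiv ℝ χ z v‖ ≤ Cχ * ‖v‖)
    (x y : ℂ → ℝ) (hx : Continuous x) (hyc : Continuous y) (hy0 : ∀ z, 0 ≤ y z)
    (hwy : ∀ z, ‖w z‖ ≤ y z)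
    (hwx : ∀ z, ‖fderiv ℝ w z 1‖ ≤ x z ∧ ‖fderiv ℝ w z Complex.I‖ ≤ x z) :
    (∫ z, ‖χ z • w z‖ ^ 4) ≤ CL * ((∫ z in closedBall (0 : ℂ) ρ, y z ^ 2) *
      (4 * (∫ z in closedBall (0 : ℂ) ρ, x z ^ 2) + 4 * Cχ ^ 2 * ∫ z in closedBall (0 : ℂ) ρ, y z ^ 2)) := by
  have hW : ContDiff ℝ ∞ (fun t => χ t • w t) := hχ.smul hw
  have hWc : HasCompactSupport (fun t => χ t • w t) := hχc.smul_right
  have hCχ0 : 0 ≤ Cχ := by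
    have := hCχ 0 1
    rw [norm_one, mul_one] at this
    exact (norm_nonneg _).trans this
  refine (hL _ hW hWc).trans (mul_le_mul_of_nonneg_left ?_ hCL)
  have hx0 : ∀ z, 0 ≤ x z := fun z => (norm_nonneg _).trans (hwx z).1
  -- `∫ ‖χ w‖² ≤ ∫_{D_ρ} y²`
  have hzero0 : ∀ z, z ∉ closedBall (0 : ℂ) ρ → ‖χ z • w z‖ ^ 2 = 0 := by
    intro z hz
    have hz' : z ∉ tsupport χ := fun h => hz (mem_closedBall_zero_iff.mpr (hsupp z h))
    simp [image_eq_zero_of_notMem_tsupport hz']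
  have h2 : (∫ z, ‖χ z • w z‖ ^ 2) ≤ ∫ z in closedBall (0 : ℂ) ρ, y z ^ 2 := by
    rw [integral_eq_setIntegral_of_forall hzero0]
    refine setIntegral_mono_on (integrableOn_closedBall_of_continuous
        ((hχ.continuous.smul hw.continuous).norm.pow 2) 0 ρ)
      (integrableOn_closedBall_of_continuous (hyc.pow 2) 0 ρ) measurableSet_closedBall fun z _ => ?_
    have : ‖χ z • w z‖ ≤ y z := by
      rw [norm_smul, Real.norm_eq_abs]
      calc |χ z| * ‖w z‖ ≤ 1 * y z := mul_le_mul (hχ1 z) (hwy z) (norm_nonneg _) zero_le_one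
        _ = y z := one_mul _
    exact pow_le_pow_left₀ (norm_nonneg _) this 2
  -- `∫ ‖∂₁(χw)‖² + ‖∂₂(χw)‖² ≤ 4 ∫_{D_ρ} x² + 4 Cχ² ∫_{D_ρ} y²`
  have hdW : ∀ z v, fderiv ℝ (fun t => χ t • w t) z v = χ z • fderiv ℝ w z v + fderiv ℝ χ z v • w z :=
    fun z v => fderiv_smul_apply' hχ hw z v
  have hzero1 : ∀ z, z ∉ closedBall (0 : ℂ) ρ →
      ‖fderiv ℝ (fun t => χ t • w t) z 1‖ ^ 2 + ‖fderiv ℝ (fun t => χ t • w t) z Complex.I‖ ^ 2 = 0 := by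
    intro z hz
    have hz' : z ∉ tsupport χ := fun h => hz (mem_closedBall_zero_iff.mpr (hsupp z h))
    have hz'' : z ∉ tsupport (fun t => χ t • w t) := fun h => hz' (tsupport_smul_subset_left _ _ h)
    simp [fderiv_eq_zero_of_notMem_tsupport hz'']
  have hpt : ∀ z, ‖fderiv ℝ (fun t => χ t • w t) z 1‖ ^ 2 +
      ‖fderiv ℝ (fun t => χ t • w t) z Complex.I‖ ^ 2 ≤ 4 * x z ^ 2 + 4 * Cχ ^ 2 * y z ^ 2 := by
    intro z
    have hb : ∀ v : ℂ, ‖v‖ = 1 → ‖fderiv ℝ w z v‖ ≤ x z →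
        ‖fderiv ℝ (fun t => χ t • w t) z v‖ ^ 2 ≤ 2 * x z ^ 2 + 2 * Cχ ^ 2 * y z ^ 2 := by
      intro v hv hwv
      rw [hdW]
      have t1 : ‖χ z • fderiv ℝ w z v‖ ≤ x z := by
        rw [norm_smul, Real.norm_eq_abs]
        calc |χ z| * ‖fderiv ℝ w z v‖ ≤ 1 * x z := mul_le_mul (hχ1 z) hwv (norm_nonneg _) zero_le_one
          _ = x z := one_mul _
      have t2 : ‖fderiv ℝ χ z v • w z‖ ≤ Cχ * y z := by
        rw [norm_smul]
        have := hCχ z v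
        rw [hv, mul_one] at this
        exact mul_le_mul this (hwy z) (norm_nonneg _) hCχ0
      have hsum := (norm_add_le _ _).trans (add_le_add t1 t2)
      have h0 : 0 ≤ x z + Cχ * y z := by have := hx0 z; have := hy0 z; positivity
      calc ‖χ z • fderiv ℝ w z v + fderiv ℝ χ z v • w z‖ ^ 2 ≤ (x z + Cχ * y z) ^ 2 :=
            pow_le_pow_left₀ (norm_nonneg _) hsum 2
        _ ≤ 2 * x z ^ 2 + 2 * Cχ ^ 2 * y z ^ 2 := by nlinarith [sq_nonneg (x z - Cχ * y z)]
    have := hb 1 norm_one (hwx z).1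
    have := hb Complex.I Complex.norm_I (hwx z).2
    linarith
  have hcont : Continuous fun z => ‖fderiv ℝ (fun t => χ t • w t) z 1‖ ^ 2 +
      ‖fderiv ℝ (fun t => χ t • w t) z Complex.I‖ ^ 2 :=
    (((hW.continuous_fderiv (by simp)).clm_apply continuous_const).norm.pow 2).add
      (((hW.continuous_fderiv (by simp)).clm_apply continuous_const).norm.pow 2)
  have h3 : (∫ z, (‖fderiv ℝ (fun t => χ t • w t) z 1‖ ^ 2 +
      ‖fderiv ℝ (fun t => χ t • w t) z Complex.I‖ ^ 2)) ≤
      4 * (∫ z in closedBall (0 : ℂ) ρ, x z ^ 2) + 4 * Cχ ^ 2 * ∫ z in closedBall (0 : ℂ) ρ, y z ^ 2 := by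
    rw [integral_eq_setIntegral_of_forall hzero1]
    have iA : IntegrableOn (fun z => 4 * x z ^ 2) (closedBall (0 : ℂ) ρ) :=
      integrableOn_closedBall_of_continuous (continuous_const.mul (hx.pow 2)) 0 ρ
    have iB : IntegrableOn (fun z => 4 * Cχ ^ 2 * y z ^ 2) (closedBall (0 : ℂ) ρ) :=
      integrableOn_closedBall_of_continuous (continuous_const.mul (hyc.pow 2)) 0 ρ
    calc _ ≤ ∫ z in closedBall (0 : ℂ) ρ, (4 * x z ^ 2 + 4 * Cχ ^ 2 * y z ^ 2) :=
          setIntegral_mono_on (integrableOn_closedBall_of_continuous hcont 0 ρ) (iA.add iB)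
            measurableSet_closedBall fun z _ => hpt z
      _ = _ := by rw [integral_add iA iB, integral_const_mul, integral_const_mul]
  have hI0 : 0 ≤ ∫ z, ‖χ z • w z‖ ^ 2 := integral_nonneg fun z => by positivity
  have hy2 : 0 ≤ ∫ z in closedBall (0 : ℂ) ρ, y z ^ 2 := integral_nonneg fun z => by positivity
  have hJ0 : 0 ≤ ∫ z, (‖fderiv ℝ (fun t => χ t • w t) z 1‖ ^ 2 +
      ‖fderiv ℝ (fun t => χ t • w t) z Complex.I‖ ^ 2) := integral_nonneg fun z => by positivity
  exact mul_le_mul h2 h3 hJ0 hy2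

/-- **Step β (`L⁴` from `L²`).**
`∫_{D_{ρ'}} ‖Dⁿg‖⁴ ≤ C (∫_{D_ρ} ‖Dⁿg‖²) (∫_{D_ρ} ‖D^{n+1}g‖² + ∫_{D_ρ} ‖Dⁿg‖²)` with `C` independent of
the `C^∞` map `g`. -/
theorem beta
    (hL : ∃ C : ℝ, ∀ (W : ℂ → E4), ContDiff ℝ ∞ W → HasCompactSupport W →
      (∫ z, ‖W z‖ ^ 4) ≤ C * ((∫ z, ‖W z‖ ^ 2) *
        ∫ z, (‖fderiv ℝ W z 1‖ ^ 2 + ‖fderiv ℝ W z Complex.I‖ ^ 2)))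
    (hB : ∀ (n : ℕ) (T : ContinuousMultilinearMap ℝ (fun _ : Fin n => ℂ) E4),
      ‖T‖ ≤ ∑ L : Fin n → Fin 2, ‖T (fun j => ![(1 : ℂ), Complex.I] (L j))‖)
    (n : ℕ) {ρ' ρ : ℝ} (hρ' : 0 < ρ') (hρ'ρ : ρ' < ρ) :
    ∃ C : ℝ, ∀ g : ℂ → E4, ContDiff ℝ ∞ g →
      ∫ z in closedBall (0 : ℂ) ρ', ‖iteratedFDeriv ℝ n g z‖ ^ 4 ≤
        C * ((∫ z in closedBall (0 : ℂ) ρ, ‖iteratedFDeriv ℝ n g z‖ ^ 2) *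
          ((∫ z in closedBall (0 : ℂ) ρ, ‖iteratedFDeriv ℝ (n + 1) g z‖ ^ 2) +
            ∫ z in closedBall (0 : ℂ) ρ, ‖iteratedFDeriv ℝ n g z‖ ^ 2)) := by
  obtain ⟨CL₀, hCL₀⟩ := hL
  -- a nonnegative Ladyzhenskaya constant
  have hL' : ∀ (W : ℂ → E4), ContDiff ℝ ∞ W → HasCompactSupport W →
      (∫ z, ‖W z‖ ^ 4) ≤ max CL₀ 0 * ((∫ z, ‖W z‖ ^ 2) *
        ∫ z, (‖fderiv ℝ W z 1‖ ^ 2 + ‖fderiv ℝ W z Complex.I‖ ^ 2)) := by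
    intro W hW hWc
    refine (hCL₀ W hW hWc).trans (mul_le_mul_of_nonneg_right (le_max_left _ _) ?_)
    exact mul_nonneg (integral_nonneg fun z => by positivity) (integral_nonneg fun z => by positivity)
  have hCL : 0 ≤ max CL₀ 0 := le_max_right _ _
  let χ : ContDiffBump (0 : ℂ) := ⟨(2 * ρ' + ρ) / 3, (ρ' + 2 * ρ) / 3, by linarith, by linarith⟩
  have hχIn : ρ' < χ.rIn := by show ρ' < (2 * ρ' + ρ) / 3; linarith
  have hχOut : χ.rOut < ρ := by show (ρ' + 2 * ρ) / 3 < ρ; linarith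
  have hχc : ContDiff ℝ ∞ (χ : ℂ → ℝ) := χ.contDiff
  have hχs : HasCompactSupport (χ : ℂ → ℝ) := χ.hasCompactSupport
  obtain ⟨Cχ, hCχ⟩ : ∃ C, ∀ z, ‖fderiv ℝ (χ : ℂ → ℝ) z‖ ≤ C :=
    (hχs.fderiv (𝕜 := ℝ)).exists_bound_of_continuous (hχc.continuous_fderiv (by simp))
  have hCχv : ∀ z v, ‖fderiv ℝ (χ : ℂ → ℝ) z v‖ ≤ Cχ * ‖v‖ := fun z v =>
    (ContinuousLinearMap.le_opNorm _ _).trans (mul_le_mul_of_nonneg_right (hCχ z) (norm_nonneg _))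
  have hχ1 : ∀ z, |(χ : ℂ → ℝ) z| ≤ 1 := fun z => by
    rw [abs_of_nonneg χ.nonneg]; exact χ.le_one
  have hsuppχ : ∀ z ∈ tsupport (χ : ℂ → ℝ), ‖z‖ ≤ ρ := by
    intro z hz
    rw [χ.tsupport_eq] at hz
    exact (mem_closedBall_zero_iff.mp hz).trans hχOut.le
  refine ⟨(8 : ℝ) ^ n * 2 ^ n * (max CL₀ 0 * (4 + 4 * Cχ ^ 2)), fun g hg => ?_⟩
  obtain ⟨I2, hI2⟩ : ∃ I2 : ℝ, I2 = ∫ z in closedBall (0 : ℂ) ρ, ‖iteratedFDeriv ℝ n g z‖ ^ 2 :=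
    ⟨_, rfl⟩
  obtain ⟨I2', hI2'⟩ : ∃ I2' : ℝ, I2' = ∫ z in closedBall (0 : ℂ) ρ, ‖iteratedFDeriv ℝ (n + 1) g z‖ ^ 2 :=
    ⟨_, rfl⟩
  have hI20 : 0 ≤ I2 := by rw [hI2]; exact integral_nonneg fun z => by positivity
  have hI2'0 : 0 ≤ I2' := by rw [hI2']; exact integral_nonneg fun z => by positivity
  rw [← hI2, ← hI2']
  have hac : ∀ k, Continuous fun z => ‖iteratedFDeriv ℝ k g z‖ := fun k =>
    (hg.continuous_iteratedFDeriv (m := k) (by exact_mod_cast le_top)).norm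
  -- per word
  have key : ∀ L : Fin n → Fin 2,
      (∫ z, ‖χ z • iteratedFDeriv ℝ n g z (fun j => ![(1 : ℂ), Complex.I] (L j))‖ ^ 4) ≤
        max CL₀ 0 * (I2 * (4 * I2' + 4 * Cχ ^ 2 * I2)) := by
    intro L
    have hw : ContDiff ℝ ∞ (iteratedFDeriv ℝ n g · (fun j => ![(1 : ℂ), Complex.I] (L j))) :=
      contDiff_iteratedFDeriv_apply hg n _
    have h := beta_word hL' hCL _ hw χ hχc hχs hsuppχ hχ1 hCχv
      (fun z => ‖iteratedFDeriv ℝ (n + 1) g z‖) (fun z => ‖iteratedFDeriv ℝ n g z‖) (hac _) (hac _)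
      (fun z => norm_nonneg _) (fun z => norm_iteratedFDeriv_apply_basis_le g n L z)
      (fun z => ⟨by simpa using norm_fderiv_word_le hg n L 0 z,
        by simpa using norm_fderiv_word_le hg n L 1 z⟩)
    rw [← hI2, ← hI2'] at h
    exact h
  -- the left-hand side on the small disc
  have hLHS : ∀ z ∈ closedBall (0 : ℂ) ρ', ‖iteratedFDeriv ℝ n g z‖ ^ 4 ≤ (8 : ℝ) ^ n *
      ∑ L : Fin n → Fin 2, ‖χ z • iteratedFDeriv ℝ n g z (fun j => ![(1 : ℂ), Complex.I] (L j))‖ ^ 4 := by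
    intro z hz
    have hχz : (χ : ℂ → ℝ) z = 1 :=
      χ.one_of_mem_closedBall (mem_closedBall_zero_iff.mpr
        ((mem_closedBall_zero_iff.mp hz).trans hχIn.le) |> fun h => by simpa using h)
    simp only [hχz, one_smul]
    exact pow_four_norm_le_of_basis hB n _
  have hG_int : ∀ L : Fin n → Fin 2, Integrable (fun z =>
      ‖χ z • iteratedFDeriv ℝ n g z (fun j => ![(1 : ℂ), Complex.I] (L j))‖ ^ 4) := by
    intro L
    have hWc : HasCompactSupport (fun t => χ t • iteratedFDeriv ℝ n g t (fun j => ![(1 : ℂ), Complex.I] (L j))) :=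
      hχs.smul_right
    exact ((χ.continuous.smul (contDiff_iteratedFDeriv_apply hg n _).continuous).norm.pow 4)
      |>.integrable_of_hasCompactSupport (hasCompactSupport_of_eq_zero hWc fun z hz => by
        simp [image_eq_zero_of_notMem_tsupport hz])
  have hcard : ((Finset.univ : Finset (Fin n → Fin 2)).card : ℝ) = 2 ^ n := by simp
  calc ∫ z in closedBall (0 : ℂ) ρ', ‖iteratedFDeriv ℝ n g z‖ ^ 4
      ≤ ∫ z in closedBall (0 : ℂ) ρ', (8 : ℝ) ^ n *
          ∑ L : Fin n → Fin 2, ‖χ z • iteratedFDeriv ℝ n g z (fun j => ![(1 : ℂ), Complex.I] (L j))‖ ^ 4 := by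
        refine setIntegral_mono_on (integrableOn_closedBall_of_continuous ((hac _).pow 4) 0 ρ') ?_
          measurableSet_closedBall hLHS
        exact ((integrable_finsetSum _ fun L _ => hG_int L).const_mul _).integrableOn
    _ = (8 : ℝ) ^ n * ∑ L : Fin n → Fin 2, ∫ z in closedBall (0 : ℂ) ρ',
          ‖χ z • iteratedFDeriv ℝ n g z (fun j => ![(1 : ℂ), Complex.I] (L j))‖ ^ 4 := by
        rw [integral_const_mul, integral_finsetSum _ fun L _ => (hG_int L).integrableOn]
    _ ≤ (8 : ℝ) ^ n * ∑ L : Fin n → Fin 2, max CL₀ 0 * (I2 * (4 * I2' + 4 * Cχ ^ 2 * I2)) := by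
        refine mul_le_mul_of_nonneg_left (Finset.sum_le_sum fun L _ => ?_) (pow_nonneg (by norm_num) _)
        exact (setIntegral_le_integral (hG_int L) (Filter.Eventually.of_forall fun z =>
          pow_nonneg (norm_nonneg _) 4)).trans (key L)
    _ = (8 : ℝ) ^ n * 2 ^ n * (max CL₀ 0 * (I2 * (4 * I2' + 4 * Cχ ^ 2 * I2))) := by
        rw [Finset.sum_const, Finset.card_univ, ← Finset.card_univ, nsmul_eq_mul, hcard]; ring
    _ ≤ (8 : ℝ) ^ n * 2 ^ n * (max CL₀ 0 * (4 + 4 * Cχ ^ 2)) * (I2 * (I2' + I2)) := by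
        have h0 : I2 * (4 * I2' + 4 * Cχ ^ 2 * I2) ≤ (4 + 4 * Cχ ^ 2) * (I2 * (I2' + I2)) := by
          nlinarith [mul_nonneg hI20 hI2'0, mul_nonneg hI20 hI20, sq_nonneg Cχ,
            mul_nonneg (mul_nonneg hI20 hI2'0) (sq_nonneg Cχ), mul_nonneg (mul_nonneg hI20 hI20) (sq_nonneg Cχ)]
        have h1 := mul_le_mul_of_nonneg_left h0 hCL
        have h2 := mul_le_mul_of_nonneg_left h1 (by positivity : (0 : ℝ) ≤ 8 ^ n * 2 ^ n)
        nlinarith [h2]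

end Beta

end Apriori

end Summit.SmoothPoincare4.SmoothPoincare4.Cruxes.TameOrBrodyR4.Sketch
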